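import Mathlib
import Summits.ValiantsHypothesis.ValiantsHypothesis.Theorems.FifoMatchingNNLinearDegreeCofactorHardCofactorRemoval
import Summits.ValiantsHypothesis.ValiantsHypothesis.Theorems.FifoMatchingNNLowDegreeCofactorHardCarveMatchings
import Literature.Computability.AlgebraicComplexity.NestFreeMatchingPoly
import Literature.Computability.AlgebraicComplexity.ValiantClassesProofs
import HarnessLib

/-!
# Route FifoMatching — crux `NNLinearDegreeCofactorHard` (stmt-ValiantsHypothesis-23918), line `internal_cofactor`:
# EXCISION for stub S2b — restricting the `R`-avoiding matching polynomial to an interval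

Companion of `…CofactorRemoval.lean` (S2b ⟸ a spread measure on the `R`-AVOIDING nest-free perfect
matchings `𝓕_R(2n)`, arc polynomial `P_R`).  A banded thick-queue measure cannot live on `𝓕_R` across an
`R`-cluster much longer than its thickness, so the lead's plan EXCISES: keep one interval
`I = [a, a + 2m)` (carving data `Carve.Carving n`: even offset, `m ≥ 1`) on which `R` is tame, and discard
the rest.  With the cofactor already removed this is a clean PROJECTION: fix one `R`-avoiding nest-free
perfect matching `M₀` of `[2n]` mapping the outside of `I` to itself (an "outer witness"), send the arcs of
`M₀` outside `I` to `1`, the arcs inside `I` to the renamed variables of `[2m]`, every other arc to `0`.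

* `glue…` — gluing a matching `N` of `I ≅ [2m]` with `M₀` outside `I` gives a nest-free perfect matching
  of `[2n]` (no arc of `M₀` jumps over `I`), `R`-avoiding iff `N` avoids `R' = R ∩ I` read in `[2m]`;
  `restrict ∘ glue = id`, and a matching agreeing with `M₀` outside `I` is the glue of its restriction;
* `aeval_excise_avoiding` — **excision identity**: the projection maps `P_R(2n)` to EXACTLY `P_{R'}(2m)`
  (`0/1` coefficients, no constant), hence `complexity_excise_le`: `L₊(P_{R'}(2m)) ≤ L₊(P_R(2n))`, and with
  cofactor removal `L₊(P_{R'}(2m)) ≤ L₊(NN_n · p) + 1` for every internal `p ≠ 0` on `R`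
  (`complexity_excised_le_mul_internal`);
* `denseInternalHard_of_excisedAvoidingSpread` — the body of S2b (given `a`) from: eventually, for every
  admissible `R`, SOME carving with an outer witness and a spread probability weighting of `𝓕_{R'}(2m)`
  (mass of every balanced split of `[2m]` times `4 (2^((log₂ n + c)^c) + 1)(m+1)²` below `1`).

Honest framing: plumbing for one registered stub of one line of an OPEN crux (the measure on tame `R'`
and the outer witnesses remain); the crux, `NNDivisionHard`, `NNNotVP` stay open; monotone ≠ general
(`…Barriers.ValiantsHypothesis.MonotoneGap`); nothing here bears on `VP ≠ VNP` (NOT proved).  No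
definitions (the glued matching and the substitution are written out), no named facts. [folklore]
-/

noncomputable section

-- Sub = Summit single-conjunct layout: the duplicated namespace component is mandated by the tree.
set_option linter.dupNamespace false

namespace Summit.ValiantsHypothesis.ValiantsHypothesis.Theorems.FifoMatching.NNLinearDegreeCofactorHard.InternalCofactor

open MvPolynomial Finset Literature.Computability.AlgebraicComplexity
open Summit.ValiantsHypothesis.ValiantsHypothesis.Theorems.FifoMatching.NNLowDegreeCofactorHard.FreedVertices.Carve
open scoped NNReal

variable {n : ℕ} (C : Carving n)

/-! ### An outer witness maps `I` into `I` -/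
/-- A perfect matching mapping the outside of `I` to the outside maps `I` into `I`. [folklore] -/
theorem mapsTo_I_of_outer {M₀ : Fin (2 * n) → Fin (2 * n)} (hM₀ : M₀ ∈ perfectMatchings (2 * n))
    (hout : ∀ i, i ∉ C.I → M₀ i ∉ C.I) {i : Fin (2 * n)} (hi : i ∈ C.I) : M₀ i ∈ C.I := by
  by_contra h
  have := hout (M₀ i) h
  rw [(mem_perfectMatchings.1 hM₀).1] at this
  exact this hi

/-! ### Gluing a matching of `I ≅ [2m]` with a fixed outer matching -/
/-- The glued map (`N` on `I`, `M₀` outside) at `a + j` is `a + N j`. [folklore] -/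
theorem glue_up (M₀ : Fin (2 * n) → Fin (2 * n)) (N : Fin (2 * C.m) → Fin (2 * C.m))
    (j : Fin (2 * C.m)) :
    (fun i => if i ∈ C.I then C.up (N (C.dn i)) else M₀ i) (C.up j) = C.up (N j) := by
  show (if C.up j ∈ C.I then C.up (N (C.dn (C.up j))) else M₀ (C.up j)) = C.up (N j)
  rw [if_pos (C.up_mem_I j), C.dn_up]

/-- Restricting the glued map to `I` gives back `N`. [folklore] -/
theorem restrict_glue (M₀ : Fin (2 * n) → Fin (2 * n)) (N : Fin (2 * C.m) → Fin (2 * C.m)) :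
    C.restrict (fun i => if i ∈ C.I then C.up (N (C.dn i)) else M₀ i) = N := by
  funext j
  show C.dn ((fun i => if i ∈ C.I then C.up (N (C.dn i)) else M₀ i) (C.up j)) = N j
  rw [glue_up C, C.dn_up]

/-- A map agreeing with `M₀` outside `I` and mapping `I` into `I` is the glue of its restriction.
[folklore] -/
theorem glue_restrict_eq {M₀ M : Fin (2 * n) → Fin (2 * n)} (hagree : ∀ i, i ∉ C.I → M i = M₀ i)
    (hI : ∀ j, M (C.up j) ∈ C.I) :
    (fun i => if i ∈ C.I then C.up (C.restrict M (C.dn i)) else M₀ i) = M := by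
  funext i
  by_cases hi : i ∈ C.I
  · rw [if_pos hi]
    conv_rhs => rw [← C.up_dn hi]
    exact C.up_restrict hI _
  · rw [if_neg hi, hagree i hi]

/-- **Gluing is nest-free.**  If `M₀` is a nest-free perfect matching of `[2n]` mapping the outside of
`I` to itself and `N` is a nest-free perfect matching of `[2m] ≅ I`, the glued map is a nest-free perfect
matching of `[2n]` (an arc of `M₀` outside `I` cannot jump over `I`: it would nest the arc of `M₀` at
the left end of `I`). [folklore] -/
theorem glue_mem_nestFreeMatchings {M₀ : Fin (2 * n) → Fin (2 * n)}
    (hM₀ : M₀ ∈ nestFreeMatchings (2 * n)) (hout : ∀ i, i ∉ C.I → M₀ i ∉ C.I)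
    {N : Fin (2 * C.m) → Fin (2 * C.m)} (hN : N ∈ nestFreeMatchings (2 * C.m)) :
    (fun i => if i ∈ C.I then C.up (N (C.dn i)) else M₀ i) ∈ nestFreeMatchings (2 * n) := by
  obtain ⟨hperf₀, hnest₀⟩ := mem_nestFreeMatchings.1 hM₀
  obtain ⟨hinv₀, hfp₀⟩ := mem_perfectMatchings.1 hperf₀
  obtain ⟨⟨hinv, hfp⟩, hnest⟩ := (and_congr_left' mem_perfectMatchings).1 (mem_nestFreeMatchings.1 hN)
  have hin : ∀ {i}, i ∈ C.I → M₀ i ∈ C.I := fun hi => mapsTo_I_of_outer C hperf₀ hout hi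
  set G : Fin (2 * n) → Fin (2 * n) := fun i => if i ∈ C.I then C.up (N (C.dn i)) else M₀ i
  have hGin : ∀ {i}, i ∈ C.I → G i = C.up (N (C.dn i)) := fun hi => if_pos hi
  have hGout : ∀ {i}, i ∉ C.I → G i = M₀ i := fun hi => if_neg hi
  refine mem_nestFreeMatchings.2 ⟨mem_perfectMatchings.2 ⟨fun i => ?_, fun i h => ?_⟩, ?_⟩
  · by_cases hi : i ∈ C.I
    · rw [hGin hi, hGin (C.up_mem_I _), C.dn_up, hinv, C.up_dn hi]
    · rw [hGout hi, hGout (hout i hi), hinv₀]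
  · by_cases hi : i ∈ C.I
    · rw [hGin hi] at h
      have h' : C.up (N (C.dn i)) = C.up (C.dn i) := by rw [h, C.up_dn hi]
      exact hfp _ (C.up_injective h')
    · rw [hGout hi] at h
      exact hfp₀ i h
  · intro i j hij hj hji
    by_cases hjI : j ∈ C.I
    · have hGj : G j ∈ C.I := by rw [hGin hjI]; exact C.up_mem_I _
      by_cases hiI : i ∈ C.I
      · rw [hGin hiI] at hji
        rw [hGin hjI] at hj hji
        refine hnest (C.dn i) (C.dn j) ?_ ?_ ?_
        · rw [← C.up_lt_up, C.up_dn hiI, C.up_dn hjI]; exact hij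
        · rw [← C.up_lt_up, C.up_dn hjI]; exact hj
        · rw [← C.up_lt_up]; exact hji
      · -- `i` outside, `j` inside: the arc `(i, M₀ i)` of `M₀` jumps over the point `j` of `I`
        rw [hGout hiI] at hji
        have hlt : j < M₀ i := hj.trans hji
        rcases lt_or_gt_of_ne (hfp₀ j) with hjlt | hjgt
        · -- `M₀ j < j`: the arc `(M₀ j, j)` of `M₀` is nested in `(i, M₀ i)`
          have h1 : i < M₀ j := by
            rw [Fin.lt_def]
            have hiI' := hiI
            rw [C.mem_I] at hiI'
            have hjm := (C.mem_I.1 (hin hjI)).1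
            have hij' := Fin.lt_def.1 hij
            have hjI' := (C.mem_I.1 hjI)
            omega
          exact hnest₀ i (M₀ j) h1 (by rw [hinv₀]; exact hjlt) (by rw [hinv₀]; exact hlt)
        · -- `j < M₀ j`: the arc `(j, M₀ j)` of `M₀` is nested in `(i, M₀ i)`
          refine hnest₀ i j hij hjgt ?_
          rw [Fin.lt_def]
          have hMj := (C.mem_I.1 (hin hjI)).2
          have hMi : M₀ i ∉ C.I := hout i hiI
          rw [C.mem_I] at hMi
          have hlt' := Fin.lt_def.1 hlt
          have hjI' := (C.mem_I.1 hjI).1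
          omega
    · rw [hGout hjI] at hj hji
      by_cases hiI : i ∈ C.I
      · -- `i` inside, `j` outside, `G i` inside: `j` lies between two points of `I`
        have hGi : G i ∈ C.I := by rw [hGin hiI]; exact C.up_mem_I _
        exact hjI (C.mem_I_of_between hiI hGi hij (hj.trans hji))
      · rw [hGout hiI] at hji
        exact hnest₀ i j hij hj hji

/-- `R`-avoidance of the glued matching: it avoids `R` iff `N` avoids `R' = R ∩ I` read in `[2m]`
(given that `M₀` avoids `R`). [folklore] -/
theorem glue_avoiding_iff (R : Finset (Fin (2 * n))) {M₀ : Fin (2 * n) → Fin (2 * n)}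
    (hR₀ : ∀ i ∈ R, M₀ i ∉ R) (N : Fin (2 * C.m) → Fin (2 * C.m)) :
    (∀ i ∈ R, (fun i => if i ∈ C.I then C.up (N (C.dn i)) else M₀ i) i ∉ R) ↔
      ∀ j ∈ (univ.filter fun j : Fin (2 * C.m) => C.up j ∈ R),
        N j ∉ (univ.filter fun j : Fin (2 * C.m) => C.up j ∈ R) := by
  simp only [mem_filter, mem_univ, true_and]
  constructor
  · intro h j hj hNj
    have := h (C.up j) hj
    rw [if_pos (C.up_mem_I j), C.dn_up] at this
    exact this hNj
  · intro h i hi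
    by_cases hiI : i ∈ C.I
    · rw [if_pos hiI]
      refine h (C.dn i) ?_
      rw [C.up_dn hiI]; exact hi
    · rw [if_neg hiI]
      exact hR₀ i hi

/-! ### The excision substitution and the image of one arc monomial -/
/-- The excision substitution (arcs inside `I` renamed, arcs `(i, M₀ i)` with `i ∉ I` freed, all other
arcs killed) is a projection. [folklore] -/
theorem isProjection_aeval_excise (M₀ : Fin (2 * n) → Fin (2 * n))
    (q : MvPolynomial (Fin (2 * n) × Fin (2 * n)) ℝ≥0) :
    IsProjection (aeval (fun e : Fin (2 * n) × Fin (2 * n) =>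
      if e.1 ∈ C.I ∧ e.2 ∈ C.I then (X (C.dn e.1, C.dn e.2) : MvPolynomial (Fin (2 * C.m) × Fin (2 * C.m)) ℝ≥0)
      else if e.1 ∉ C.I ∧ M₀ e.1 = e.2 then 1 else 0) q) q := by
  refine ⟨_, fun e => ?_, rfl⟩
  by_cases h : e.1 ∈ C.I ∧ e.2 ∈ C.I
  · exact Or.inl ⟨_, by rw [if_pos h]⟩
  · by_cases h' : e.1 ∉ C.I ∧ M₀ e.1 = e.2
    · exact Or.inr ⟨1, by rw [if_neg h, if_pos h', C_1]⟩
    · exact Or.inr ⟨0, by rw [if_neg h, if_neg h', C_0]⟩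

/-- **The image of one matching monomial under excision.**  For a perfect matching `M` of `[2n]` and an
outer witness `M₀` (mapping the outside of `I` to itself): `x^M ↦ x^{M|_I}` (the arc monomial of the
restriction) if `M` agrees with `M₀` outside `I`, and `x^M ↦ 0` otherwise. [folklore] -/
theorem aeval_excise_arcMonomial {M₀ : Fin (2 * n) → Fin (2 * n)} (hM₀ : M₀ ∈ perfectMatchings (2 * n))
    (hout : ∀ i, i ∉ C.I → M₀ i ∉ C.I)
    {M : Fin (2 * n) → Fin (2 * n)} (hM : M ∈ perfectMatchings (2 * n)) :
    aeval (fun e : Fin (2 * n) × Fin (2 * n) =>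
      if e.1 ∈ C.I ∧ e.2 ∈ C.I then (X (C.dn e.1, C.dn e.2) : MvPolynomial (Fin (2 * C.m) × Fin (2 * C.m)) ℝ≥0)
      else if e.1 ∉ C.I ∧ M₀ e.1 = e.2 then 1 else 0) (arcMonomial ℝ≥0 M) =
      if (∀ i, i ∉ C.I → M i = M₀ i) then arcMonomial ℝ≥0 (C.restrict M) else 0 := by
  obtain ⟨hinv, hfp⟩ := mem_perfectMatchings.1 hM
  obtain ⟨hinv₀, -⟩ := mem_perfectMatchings.1 hM₀
  rw [arcMonomial_eq_prod_openers, map_prod]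
  simp only [aeval_X]
  split_ifs with hagree
  · -- `M` agrees with `M₀` outside `I`, hence maps `I` into `I`
    have hI : ∀ {i}, i ∈ C.I → M i ∈ C.I := by
      intro i hi
      by_contra h
      have h1 := hagree (M i) h
      rw [hinv] at h1
      have h2 : M₀ (M i) ∈ C.I := by rw [← h1]; exact hi
      exact hout (M i) h h2
    have hI' : ∀ j, M (C.up j) ∈ C.I := fun j => hI (C.up_mem_I j)
    have key : ∀ i ∈ openers M,
        (if i ∈ C.I ∧ M i ∈ C.I then (X (C.dn i, C.dn (M i)) :
            MvPolynomial (Fin (2 * C.m) × Fin (2 * C.m)) ℝ≥0)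
          else if i ∉ C.I ∧ M₀ i = M i then 1 else 0) =
        if i ∈ C.I then X (C.dn i, C.dn (M i)) else 1 := by
      intro i _
      by_cases h1 : i ∈ C.I
      · rw [if_pos ⟨h1, hI h1⟩, if_pos h1]
      · rw [if_neg (fun h => h1 h.1), if_pos ⟨h1, (hagree i h1).symm⟩, if_neg h1]
    rw [prod_congr rfl key, ← prod_filter, arcMonomial_eq_prod_openers]
    refine prod_nbij' C.dn C.up (fun i hi => ?_) (fun j hj => ?_) (fun i hi => ?_)
      (fun j _ => C.dn_up j) (fun i hi => ?_)
    · rw [mem_filter] at hi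
      rw [mem_openers, C.lt_restrict_iff hI', C.up_dn hi.2]
      exact mem_openers.1 hi.1
    · rw [mem_openers, C.lt_restrict_iff hI'] at hj
      exact mem_filter.2 ⟨mem_openers.2 hj, C.up_mem_I j⟩
    · exact C.up_dn (mem_filter.1 hi).2
    · rw [mem_filter] at hi
      show X (C.dn i, C.dn (M i)) = X (C.dn i, C.restrict M (C.dn i))
      rw [Carving.restrict, C.up_dn hi.2]
  · push Not at hagree
    obtain ⟨i, hiI, hne⟩ := hagree
    rcases lt_or_gt_of_ne (hfp i).symm with h | h
    · -- `i` is an opener outside `I`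
      apply prod_eq_zero (mem_openers.2 h)
      rw [if_neg (fun h' => hiI h'.1), if_neg (fun h' => hne h'.2.symm)]
    · -- `M i` is the opener of the arc `{M i, i}`
      apply prod_eq_zero (mem_openers.2 (show M i < M (M i) by rw [hinv]; exact h))
      rw [hinv]
      by_cases hMiI : M i ∈ C.I
      · rw [if_neg (fun h' => hiI h'.2), if_neg (fun h' => h'.1 hMiI)]
      · rw [if_neg (fun h' => hMiI h'.1), if_neg]
        rintro ⟨-, h'⟩
        have h2 := congrArg M₀ h'
        rw [hinv₀] at h2
        exact hne h2

/-! ### The excision identity -/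
/-- **Excision identity.**  For an outer witness `M₀ ∈ 𝓕_R(2n)` (nest-free perfect, `R`-avoiding,
mapping the outside of `I` to itself), the excision projection maps the arc polynomial `P_R(2n)` of the
`R`-avoiding nest-free perfect matchings of `[2n]` to EXACTLY the arc polynomial `P_{R'}(2m)` of the
`R'`-avoiding nest-free perfect matchings of `[2m]`, `R' = {j : a + j ∈ R}`: the matchings agreeing
with `M₀` outside `I` correspond bijectively (restriction / gluing) to the members of `𝓕_{R'}(2m)`.
[folklore] -/
theorem aeval_excise_avoiding (R : Finset (Fin (2 * n))) {M₀ : Fin (2 * n) → Fin (2 * n)}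
    (hM₀ : M₀ ∈ nestFreeMatchings (2 * n)) (hR₀ : ∀ i ∈ R, M₀ i ∉ R)
    (hout : ∀ i, i ∉ C.I → M₀ i ∉ C.I) :
    aeval (fun e : Fin (2 * n) × Fin (2 * n) =>
      if e.1 ∈ C.I ∧ e.2 ∈ C.I then (X (C.dn e.1, C.dn e.2) : MvPolynomial (Fin (2 * C.m) × Fin (2 * C.m)) ℝ≥0)
      else if e.1 ∉ C.I ∧ M₀ e.1 = e.2 then 1 else 0)
      (∑ M ∈ (nestFreeMatchings (2 * n)).filter (fun M => ∀ i ∈ R, M i ∉ R), arcMonomial ℝ≥0 M) =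
    ∑ N ∈ (nestFreeMatchings (2 * C.m)).filter
        (fun N => ∀ j ∈ (univ.filter fun j : Fin (2 * C.m) => C.up j ∈ R),
          N j ∉ (univ.filter fun j : Fin (2 * C.m) => C.up j ∈ R)),
      arcMonomial ℝ≥0 N := by
  have hperf₀ := nestFreeMatchings_subset_perfectMatchings hM₀
  rw [map_sum]
  -- only the matchings agreeing with `M₀` outside `I` survive
  rw [← sum_filter_add_sum_filter_not _ (fun M : Fin (2 * n) → Fin (2 * n) => ∀ i, i ∉ C.I → M i = M₀ i)]
  have hzero : ∑ M ∈ ((nestFreeMatchings (2 * n)).filter (fun M => ∀ i ∈ R, M i ∉ R)).filter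
      (fun M => ¬ ∀ i, i ∉ C.I → M i = M₀ i),
      aeval (fun e : Fin (2 * n) × Fin (2 * n) =>
        if e.1 ∈ C.I ∧ e.2 ∈ C.I then (X (C.dn e.1, C.dn e.2) :
          MvPolynomial (Fin (2 * C.m) × Fin (2 * C.m)) ℝ≥0)
        else if e.1 ∉ C.I ∧ M₀ e.1 = e.2 then 1 else 0) (arcMonomial ℝ≥0 M) = 0 := by
    refine sum_eq_zero fun M hM => ?_
    obtain ⟨hM1, hM2⟩ := mem_filter.1 hM
    rw [aeval_excise_arcMonomial C hperf₀ hout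
      (nestFreeMatchings_subset_perfectMatchings (mem_filter.1 hM1).1), if_neg hM2]
  rw [hzero, add_zero]
  -- the survivors, reindexed by restriction / gluing
  refine sum_nbij' C.restrict (fun N i => if i ∈ C.I then C.up (N (C.dn i)) else M₀ i)
    (fun M hM => ?_) (fun N hN => ?_) (fun M hM => ?_) (fun N _ => restrict_glue C M₀ N) (fun M hM => ?_)
  · -- restriction lands in `𝓕_{R'}(2m)`
    obtain ⟨hM1, hagree⟩ := mem_filter.1 hM
    obtain ⟨hMnf, hMR⟩ := mem_filter.1 hM1
    have hI : ∀ j, M (C.up j) ∈ C.I := fun j => by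
      by_contra h
      have h1 := hagree _ h
      rw [(mem_perfectMatchings.1 (nestFreeMatchings_subset_perfectMatchings hMnf)).1] at h1
      have h2 : M₀ (M (C.up j)) ∈ C.I := by rw [← h1]; exact C.up_mem_I j
      exact hout _ h h2
    refine mem_filter.2 ⟨C.restrict_mem_nestFreeMatchings hMnf hI, ?_⟩
    rw [← glue_avoiding_iff C R hR₀, glue_restrict_eq C hagree hI]
    exact hMR
  · -- gluing lands in the survivors
    obtain ⟨hNnf, hNR⟩ := mem_filter.1 hN
    refine mem_filter.2 ⟨mem_filter.2 ⟨glue_mem_nestFreeMatchings C hM₀ hout hNnf,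
      (glue_avoiding_iff C R hR₀ N).2 hNR⟩, fun i hi => ?_⟩
    exact if_neg hi
  · -- glue ∘ restrict = id on the survivors
    obtain ⟨hM1, hagree⟩ := mem_filter.1 hM
    obtain ⟨hMnf, -⟩ := mem_filter.1 hM1
    have hI : ∀ j, M (C.up j) ∈ C.I := fun j => by
      by_contra h
      have h1 := hagree _ h
      rw [(mem_perfectMatchings.1 (nestFreeMatchings_subset_perfectMatchings hMnf)).1] at h1
      have h2 : M₀ (M (C.up j)) ∈ C.I := by rw [← h1]; exact C.up_mem_I j
      exact hout _ h h2
    exact glue_restrict_eq C hagree hI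
  · -- the summands agree
    obtain ⟨hM1, hagree⟩ := mem_filter.1 hM
    rw [aeval_excise_arcMonomial C hperf₀ hout
      (nestFreeMatchings_subset_perfectMatchings (mem_filter.1 hM1).1), if_pos hagree]

/-- **Excision is free:** `L₊(P_{R'}(2m)) ≤ L₊(P_R(2n))` for every outer witness `M₀`. [folklore] -/
theorem complexity_excise_le (R : Finset (Fin (2 * n))) {M₀ : Fin (2 * n) → Fin (2 * n)}
    (hM₀ : M₀ ∈ nestFreeMatchings (2 * n)) (hR₀ : ∀ i ∈ R, M₀ i ∉ R)
    (hout : ∀ i, i ∉ C.I → M₀ i ∉ C.I) :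
    complexity (∑ N ∈ (nestFreeMatchings (2 * C.m)).filter
        (fun N => ∀ j ∈ (univ.filter fun j : Fin (2 * C.m) => C.up j ∈ R),
          N j ∉ (univ.filter fun j : Fin (2 * C.m) => C.up j ∈ R)), arcMonomial ℝ≥0 N) ≤
      complexity (∑ M ∈ (nestFreeMatchings (2 * n)).filter (fun M => ∀ i ∈ R, M i ∉ R),
        arcMonomial ℝ≥0 M) := by
  rw [← aeval_excise_avoiding C R hM₀ hR₀ hout]
  exact complexity_le_of_isProjection (isProjection_aeval_excise C M₀ _)

/-- **Excision after cofactor removal:** for an internal cofactor `p ≠ 0` on `R` and an outer witness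
`M₀ ∈ 𝓕_R(2n)` for the carving, `L₊(P_{R'}(2m)) ≤ L₊(NN_n · p) + 1`. [folklore] -/
theorem complexity_excised_le_mul_internal (R : Finset (Fin (2 * n))) {M₀ : Fin (2 * n) → Fin (2 * n)}
    (hM₀ : M₀ ∈ nestFreeMatchings (2 * n)) (hR₀ : ∀ i ∈ R, M₀ i ∉ R)
    (hout : ∀ i, i ∉ C.I → M₀ i ∉ C.I)
    {p : MvPolynomial (Fin (2 * n) × Fin (2 * n)) ℝ≥0} (hp : p ≠ 0)
    (hint : ∀ d ∈ p.support, ∀ e ∈ d.support, e.1 ∈ R ∧ e.2 ∈ R) :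
    complexity (∑ N ∈ (nestFreeMatchings (2 * C.m)).filter
        (fun N => ∀ j ∈ (univ.filter fun j : Fin (2 * C.m) => C.up j ∈ R),
          N j ∉ (univ.filter fun j : Fin (2 * C.m) => C.up j ∈ R)), arcMonomial ℝ≥0 N) ≤
      complexity (nestFreeMatchingPoly n ℝ≥0 * p) + 1 :=
  (complexity_excise_le C R hM₀ hR₀ hout).trans (complexity_avoiding_le R ⟨M₀, hM₀, hR₀⟩ hp hint)

/-! ### S2b from an excised spread measure -/
/-- **Stub S2b (`stub_denseInternalHard`) for a given `a`, from an EXCISED avoiding spread measure:**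
if for every `c`, eventually in `n`, every admissible `R` (`a·|R| ≤ 2n`, no run of length `G` in the
complement) admits a carving `I = [a₀, a₀ + 2m)`, `m ≥ 3`, an outer witness `M₀` (nest-free perfect,
`R`-avoiding, outside of `I` to itself) and a weighting `μ ≥ 0` of the `R'`-avoiding nest-free perfect
matchings of `[2m]` (`R' = {j : a₀ + j ∈ R}`) of mass `1` with
`4 (2^((log₂ n + c)^c) + 1) (m+1)² · m_S < 1` for the mass `m_S` of every balanced split `S ⊆ [2m]`
(`2m < 3|S| ≤ 4m`), then the conclusion of S2b holds with this `a`. [folklore] -/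
theorem denseInternalHard_of_excisedAvoidingSpread (a : ℕ)
    (h : ∀ c : ℕ, ∃ n₀ : ℕ, ∀ n ≥ n₀, ∀ R : Finset (Fin (2 * n)), a * R.card ≤ 2 * n →
      (¬ ∃ s : ℕ, s + (2 * ((Nat.log 2 n + c) ^ c + Nat.log 2 n + 1) ^ 6 + 12) ≤ 2 * n ∧
        ∀ j : Fin (2 * n), s ≤ j.val →
          j.val < s + (2 * ((Nat.log 2 n + c) ^ c + Nat.log 2 n + 1) ^ 6 + 12) → j ∉ R) →
      ∃ C : Carving n, 3 ≤ C.m ∧ ∃ M₀ ∈ nestFreeMatchings (2 * n), (∀ i ∈ R, M₀ i ∉ R) ∧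
        (∀ i, i ∉ C.I → M₀ i ∉ C.I) ∧
        ∃ μ : (Fin (2 * C.m) → Fin (2 * C.m)) → ℝ≥0,
          (∑ N ∈ (nestFreeMatchings (2 * C.m)).filter
              (fun N => ∀ j ∈ (univ.filter fun j : Fin (2 * C.m) => C.up j ∈ R),
                N j ∉ (univ.filter fun j : Fin (2 * C.m) => C.up j ∈ R)), μ N = 1) ∧
          ∀ S : Finset (Fin (2 * C.m)), 2 * C.m < 3 * S.card → 3 * S.card ≤ 4 * C.m →
            ((4 * (2 ^ ((Nat.log 2 n + c) ^ c) + 1) * (C.m + 1) ^ 2 : ℕ) : ℝ≥0) *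
              (∑ N ∈ ((nestFreeMatchings (2 * C.m)).filter
                (fun N => ∀ j ∈ (univ.filter fun j : Fin (2 * C.m) => C.up j ∈ R),
                  N j ∉ (univ.filter fun j : Fin (2 * C.m) => C.up j ∈ R))).filter
                (fun N => ∀ i, i ∈ S ↔ N i ∈ S), μ N) < 1) :
    ∀ c : ℕ, ∃ n₀ : ℕ, ∀ n ≥ n₀, ∀ R : Finset (Fin (2 * n)), a * R.card ≤ 2 * n →
      (¬ ∃ s : ℕ, s + (2 * ((Nat.log 2 n + c) ^ c + Nat.log 2 n + 1) ^ 6 + 12) ≤ 2 * n ∧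
        ∀ j : Fin (2 * n), s ≤ j.val →
          j.val < s + (2 * ((Nat.log 2 n + c) ^ c + Nat.log 2 n + 1) ^ 6 + 12) → j ∉ R) →
      ∀ p : MvPolynomial (Fin (2 * n) × Fin (2 * n)) ℝ≥0, p ≠ 0 → a * p.totalDegree ≤ n →
        (∀ d ∈ p.support, ∀ e ∈ d.support, e.1 ∈ R ∧ e.2 ∈ R) →
          2 ^ ((Nat.log 2 n + c) ^ c) < complexity (nestFreeMatchingPoly n ℝ≥0 * p) := by
  intro c
  obtain ⟨n₀, hn₀⟩ := h c
  refine ⟨n₀, fun n hn R hR hrun p hp _ hint => ?_⟩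
  obtain ⟨C, hm3, M₀, hM₀, hR₀, hout, μ, hμ, hsmall⟩ := hn₀ n hn R hR hrun
  set R' : Finset (Fin (2 * C.m)) := univ.filter fun j : Fin (2 * C.m) => C.up j ∈ R with hR'
  set 𝓕 := (nestFreeMatchings (2 * C.m)).filter (fun N => ∀ j ∈ R', N j ∉ R') with h𝓕def
  have h𝓕 : 𝓕 ⊆ perfectMatchings (2 * C.m) :=
    (filter_subset _ _).trans nestFreeMatchings_subset_perfectMatchings
  set K := 2 ^ ((Nat.log 2 n + c) ^ c) with hK
  by_contra hle
  push Not at hle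
  have hP : complexity (∑ N ∈ 𝓕, arcMonomial ℝ≥0 N) ≤ K + 1 :=
    (complexity_excised_le_mul_internal C R hM₀ hR₀ hout hp hint).trans (Nat.add_le_add_right hle 1)
  obtain ⟨S, h1, h2, hbig⟩ := exists_balanced_split_of_complexity_family hm3 h𝓕 μ hμ
  have hlt := hsmall S h1 h2
  have hmono : ((4 * complexity (∑ N ∈ 𝓕, arcMonomial ℝ≥0 N) * (C.m + 1) ^ 2 : ℕ) : ℝ≥0) ≤
      ((4 * (K + 1) * (C.m + 1) ^ 2 : ℕ) : ℝ≥0) := by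
    exact_mod_cast Nat.mul_le_mul_right _ (Nat.mul_le_mul_left _ hP)
  exact absurd (lt_of_le_of_lt (hbig.trans (mul_le_mul_of_nonneg_right hmono zero_le)) hlt)
    (lt_irrefl _)

end Summit.ValiantsHypothesis.ValiantsHypothesis.Theorems.FifoMatching.NNLinearDegreeCofactorHard.InternalCofactor

end
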